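import Literature.AlgebraicGeometry.Motives.AbelianVarietyTateSimpleCharpoly
import Summits.RiemannHypothesis.RiemannHypothesis.Theorems.MotivicDoorFunctionField

/-!
# The function-field door (FF-DOOR, statement (ii)), exact form — part 1: Honda–Tate periods and
# period families of a Weil datum
(pub-rhdoor, seat ff-2, gen 3; HONEST FRAMING: lottery ticket at the motivic door; RH probability
negligible; consolation prizes are real: a new semi-local Weil-positivity theorem, or a located gap in the
Connes–Consani programme, plus the ff-door theorem.  Nothing in this file is a statement about `ζ`.)

Setting as in `MotivicDoorFunctionField`: `K = 𝔽_q` finite, `h ∈ ℤ[X]` monic, `RH(q, h) := ∀ α ∈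
frobRoots h, |α| = √q`, GEOMETRIC ORIGIN of `P` := `∃ C : AbelianVariety K, C.IsFrobCharpoly P`.
Named Literature hypotheses (D-0014, verbatim sources in the Literature files): `hW : ∀ A,
A.weilRiemannHypothesis`, `hHT : hondaTateExistence K` (`AbelianVarietyHondaTate`) and
`hT : tateSimpleRigidity K` (`AbelianVarietyTateSimpleCharpoly`: Tate, Bourbaki 352 Th. 1 (i) + p. 99 /
Waterhouse 1969 p. 526 "THEOREM (Tate)").  Each theorem names exactly the hypotheses it uses.

Vocabulary (new, problem-side; not a Literature notion).  `IsHTPeriod K m e` — "`e ≥ 1` and `m^e = P_A`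
for some `K`-simple abelian variety `A/K`": the shape of the conclusion of Honda–Tate existence.  A PERIOD
FAMILY for `h` assigns such an `e_m` to every monic irreducible factor `m` of `h`.

PROVED here (kernel; labels per item):
* `exists_isHTPeriod_of_rh` / `IsHTPeriod.rh` — a monic irreducible `m` is RH-true iff it has a period.
  [PROVED from hHT (⇒) / hW (⇐)]
* `IsHTPeriod.unique` — **the period is unique** (Waterhouse p. 527 "`π` determines `e`").  [PROVED from hT]
* `IsHTPeriod.eq_pow_of_dvd` — under `hT`, EVERY `K`-simple `A` of positive dimension with `m ∣ P_A` has
  `P_A = m^{e_m}`.  [PROVED from hT]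
* `exists_periodFamily_of_rh`, `rh_of_periodFamily`, `rh_iff_exists_periodFamily` — **`RH(q, h) ↔ h has
  a period family`** (monic `h`).  [PROVED from hHT (⇒) / hW (⇐)]
* `exists_pos_forall_period_dvd` — some `E ≥ 1` is a common multiple of all periods of the factors.
  [PROVED, no named fact]
* Arithmetic of monic integer polynomials used by part 2 (`MotivicDoorFunctionFieldExponent`):
  `monic_peel_induction` (induction by peeling off a full prime power `m^k`), the multiplicity lemmas
  `multiplicity_pow_mul_of_not_dvd`, `multiplicity_pow_mul_of_ne`, `multiplicity_prod_eq_sum` in the UFD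
  `ℤ[X]`, and `exists_mem_roots_and_mem_roots_pow_of_dvd` (common complex root).  [PROVED, folklore]

Part 2 (`MotivicDoorFunctionFieldExponent`) computes from a period family the EXACT set of exponents `E`
for which `h^E` is geometric.
-/

set_option linter.dupNamespace false  -- the mandated namespace repeats `RiemannHypothesis`

open Polynomial

namespace Summit.RiemannHypothesis.RiemannHypothesis.Theorems.MotivicDoor.FunctionField

open Literature.AlgebraicGeometry.Motives
open Summit.RiemannHypothesis.RiemannHypothesis.Theorems.PfPersistence.FfAngleTwin

universe u

variable {K : Type u} [Field K] [Finite K]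


/-! ### Arithmetic of monic integer polynomials: peeling off a prime power -/

omit [Finite K] in
/-- Peel induction for monic integer polynomials: to prove a property of all monic `h ∈ ℤ[X]` it
suffices to prove it for `1` and for `m^k · g` (`m` monic irreducible, `k ≥ 1`, `g` monic, `m ∤ g`)
assuming it for `g`. [PROVED, folklore] -/
theorem monic_peel_induction {Pr : ℤ[X] → Prop} (h1 : Pr 1)
    (hstep : ∀ (m : ℤ[X]) (k : ℕ) (g : ℤ[X]), m.Monic → Irreducible m → 0 < k → g.Monic → ¬ m ∣ g →
      Pr g → Pr (m ^ k * g)) :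
    ∀ h : ℤ[X], h.Monic → Pr h := by
  intro h hh
  suffices H : ∀ (n : ℕ) (h : ℤ[X]), h.natDegree = n → h.Monic → Pr h from H _ h rfl hh
  intro n
  induction n using Nat.strong_induction_on with
  | _ n ih =>
    intro h hn hh
    rcases Nat.eq_zero_or_pos n with rfl | hpos
    · rw [Polynomial.eq_one_of_monic_natDegree_zero hh hn]
      exact h1
    · obtain ⟨m, hm, hirr, hdvd⟩ := AbelianVariety.exists_monic_irreducible_dvd hh (hn ▸ hpos)
      have hfin : FiniteMultiplicity m h := FiniteMultiplicity.of_not_isUnit hirr.not_isUnit hh.ne_zero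
      obtain ⟨g, hg, hndvd⟩ := hfin.exists_eq_pow_mul_and_not_dvd
      have hk : 0 < multiplicity m h := Nat.pos_of_ne_zero (multiplicity_ne_zero.2 hdvd)
      have hgm : g.Monic := (hm.pow _).of_mul_monic_left (hg ▸ hh)
      have hmdeg : 0 < m.natDegree := hm.natDegree_pos.2 hirr.ne_one
      have hlt : g.natDegree < n := by
        have := congrArg Polynomial.natDegree hg
        rw [hn, (hm.pow _).natDegree_mul hgm, hm.natDegree_pow] at this
        have : 0 < multiplicity m h * m.natDegree := Nat.mul_pos hk hmdeg
        omega
      rw [hg]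
      exact hstep m _ g hm hirr hk hgm hndvd (ih _ hlt g rfl hgm)

omit [Finite K] in
/-- In `ℤ[X]`, two monic irreducible polynomials one of which divides the other are equal. [folklore] -/
theorem eq_of_monic_irreducible_dvd {m m' : ℤ[X]} (hm : m.Monic) (hirr : Irreducible m) (hm' : m'.Monic)
    (hirr' : Irreducible m') (h : m' ∣ m) : m' = m :=
  Polynomial.eq_of_monic_of_associated hm' hm (hirr'.associated_of_dvd hirr h)

omit [Finite K] in
/-- A monic irreducible divisor of `m^k · g` (`m` monic irreducible) is `m` or divides `g`. [folklore] -/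
theorem eq_or_dvd_of_dvd_pow_mul {m m' g : ℤ[X]} (hm : m.Monic) (hirr : Irreducible m) (hm' : m'.Monic)
    (hirr' : Irreducible m') {k : ℕ} (h : m' ∣ m ^ k * g) : m' = m ∨ m' ∣ g := by
  have hp' : Prime m' := UniqueFactorizationMonoid.irreducible_iff_prime.1 hirr'
  rcases hp'.dvd_or_dvd h with h1 | h2
  · exact Or.inl (eq_of_monic_irreducible_dvd hm hirr hm' hirr' (hp'.dvd_of_dvd_pow h1))
  · exact Or.inr h2

omit [Finite K] in
/-- `mult_m(m^k · g) = k` when `m ∤ g` (`m` irreducible, `g ≠ 0`). [folklore] -/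
theorem multiplicity_pow_mul_of_not_dvd {m g : ℤ[X]} (hirr : Irreducible m) (k : ℕ) (hg : g ≠ 0)
    (hndvd : ¬ m ∣ g) : multiplicity m (m ^ k * g) = k := by
  have hp : Prime m := UniqueFactorizationMonoid.irreducible_iff_prime.1 hirr
  have hfin : FiniteMultiplicity m (m ^ k * g) :=
    FiniteMultiplicity.of_not_isUnit hirr.not_isUnit (mul_ne_zero (pow_ne_zero _ hp.ne_zero) hg)
  rw [multiplicity_mul hp hfin, multiplicity_pow_self_of_prime hp, multiplicity_eq_zero.2 hndvd, add_zero]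

omit [Finite K] in
/-- `mult_{m'}(m^k · g) = mult_{m'}(g)` for monic irreducible `m' ≠ m` (`g ≠ 0`). [folklore] -/
theorem multiplicity_pow_mul_of_ne {m m' g : ℤ[X]} (hm : m.Monic) (hirr : Irreducible m) (hm' : m'.Monic)
    (hirr' : Irreducible m') (hne : m' ≠ m) (k : ℕ) (hg : g ≠ 0) :
    multiplicity m' (m ^ k * g) = multiplicity m' g := by
  have hp : Prime m := UniqueFactorizationMonoid.irreducible_iff_prime.1 hirr
  have hp' : Prime m' := UniqueFactorizationMonoid.irreducible_iff_prime.1 hirr'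
  have hfin : FiniteMultiplicity m' (m ^ k * g) :=
    FiniteMultiplicity.of_not_isUnit hirr'.not_isUnit (mul_ne_zero (pow_ne_zero _ hp.ne_zero) hg)
  have h0 : multiplicity m' (m ^ k) = 0 := by
    refine multiplicity_eq_zero.2 fun h => hne ?_
    exact eq_of_monic_irreducible_dvd hm hirr hm' hirr' (hp'.dvd_of_dvd_pow h)
  rw [multiplicity_mul hp' hfin, h0, zero_add]

omit [Finite K] in
/-- Multiplicity of a prime in a finite product of non-zero elements of `ℤ[X]` is the sum of the
multiplicities. [folklore] -/
theorem multiplicity_prod_eq_sum {ι : Type*} {p : ℤ[X]} (hp : Prime p) (s : Finset ι) (f : ι → ℤ[X])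
    (hf : ∀ i ∈ s, f i ≠ 0) : multiplicity p (∏ i ∈ s, f i) = ∑ i ∈ s, multiplicity p (f i) := by
  induction s using Finset.cons_induction with
  | empty =>
    rw [Finset.prod_empty, Finset.sum_empty]
    exact multiplicity_eq_zero.2 fun h => hp.not_unit (isUnit_of_dvd_one h)
  | cons a s ha ih =>
    have hfa : f a ≠ 0 := hf a (Finset.mem_cons.2 (Or.inl rfl))
    have hfs : ∀ i ∈ s, f i ≠ 0 := fun i hi => hf i (Finset.mem_cons.2 (Or.inr hi))
    rw [Finset.prod_cons, Finset.sum_cons, multiplicity_mul hp, ih hfs]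
    exact FiniteMultiplicity.of_not_isUnit hp.not_unit
      (mul_ne_zero hfa (Finset.prod_ne_zero_iff.2 hfs))

omit [Finite K] in
/-- A monic integer polynomial `m` of positive degree dividing a monic `P` has a complex root in common
with `P` and with `m^e` for every `e ≥ 1` (`ℂ` is algebraically closed). [PROVED, folklore] -/
theorem exists_mem_roots_and_mem_roots_pow_of_dvd {m P : ℤ[X]} (hm : m.Monic) (hmdeg : 0 < m.natDegree)
    (hP : P.Monic) (hdvd : m ∣ P) {e : ℕ} (he : 0 < e) :
    ∃ α : ℂ, α ∈ (P.map (Int.castRingHom ℂ)).roots ∧ α ∈ ((m ^ e).map (Int.castRingHom ℂ)).roots := by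
  have hm' : (m.map (Int.castRingHom ℂ)) ≠ 0 := (hm.map _).ne_zero
  have hdeg' : 0 < (m.map (Int.castRingHom ℂ)).degree := by
    rw [← Polynomial.natDegree_pos_iff_degree_pos,
      Polynomial.natDegree_map_eq_of_injective (RingHom.injective_int _)]
    exact hmdeg
  obtain ⟨α, hα⟩ := Complex.exists_root hdeg'
  refine ⟨α, ?_, ?_⟩
  · exact (Polynomial.mem_roots (hP.map _).ne_zero).2 (hα.dvd (Polynomial.map_dvd _ hdvd))
  · rw [Polynomial.map_pow, Polynomial.roots_pow]
    exact Multiset.mem_nsmul.2 ⟨he.ne', (Polynomial.mem_roots hm').2 hα⟩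

/-! ### Honda–Tate periods -/

variable (K) in
/-- **Honda–Tate period predicate.**  `IsHTPeriod K m e`: `e ≥ 1` and `m^e` is the characteristic
polynomial of the Frobenius of a `K`-simple abelian variety over `K` — the shape of the conclusion of
`AbelianVariety.hondaTateExistence K`; for monic irreducible `m` the exponent is unique under Tate's
theorem (`IsHTPeriod.unique`) and is Waterhouse's `e` = the period of `End⁰ A` in the Brauer group of
`ℚ(π)` (p. 527).  New vocabulary of the function-field door, not a Literature notion. -/
def IsHTPeriod (m : ℤ[X]) (e : ℕ) : Prop :=
  0 < e ∧ ∃ A : AbelianVariety K, A.IsSimple ∧ A.IsFrobCharpoly (m ^ e)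

/-- Honda–Tate existence gives a period for every monic irreducible RH-true `m`. [PROVED from the named
fact `hondaTateExistence`] -/
theorem exists_isHTPeriod_of_rh (hHT : AbelianVariety.hondaTateExistence K) {m : ℤ[X]} (hm : m.Monic)
    (hirr : Irreducible m) (hRH : ∀ α ∈ frobRoots m, ‖α‖ = Real.sqrt (Nat.card K)) :
    ∃ e : ℕ, IsHTPeriod K m e := by
  obtain ⟨A, e, hA, he, hP⟩ := hHT m hm hirr hRH
  exact ⟨e, he, A, hA, hP⟩

/-- A polynomial with a Honda–Tate period is RH-true (Weil). [PROVED from `weilRiemannHypothesis`] -/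
theorem IsHTPeriod.rh (hW : ∀ A : AbelianVariety K, A.weilRiemannHypothesis) {m : ℤ[X]} {e : ℕ}
    (h : IsHTPeriod K m e) : ∀ α ∈ frobRoots m, ‖α‖ = Real.sqrt (Nat.card K) := by
  obtain ⟨he, A, -, hP⟩ := h
  exact AbelianVariety.weil_of_isFrobCharpoly_pow hW he hP

/-- **Uniqueness of the Honda–Tate period** ("`π` determines `e`", Waterhouse p. 527), from Tate's
theorem `tateSimpleRigidity`. [PROVED from the named fact] -/
theorem IsHTPeriod.unique (hT : AbelianVariety.tateSimpleRigidity K) {m : ℤ[X]} (hm : m.Monic)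
    (hirr : Irreducible m) {e e' : ℕ} (h : IsHTPeriod K m e) (h' : IsHTPeriod K m e') : e = e' := by
  obtain ⟨he, A, hA, hP⟩ := h
  obtain ⟨he', A', hA', hP'⟩ := h'
  exact AbelianVariety.eq_of_isFrobCharpoly_pow_of_tateSimpleRigidity hT hm hirr hA hA' he he' hP hP'

/-- Under Tate's theorem, EVERY `K`-simple abelian variety whose Frobenius has a root in common with the
monic irreducible `m` has characteristic polynomial `m^e`, `e` the period. [PROVED from the named fact] -/
theorem IsHTPeriod.eq_pow_of_dvd (hT : AbelianVariety.tateSimpleRigidity K) {m : ℤ[X]} (hm : m.Monic)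
    (hirr : Irreducible m) {e : ℕ} (h : IsHTPeriod K m e) {A : AbelianVariety K} (hA : A.IsSimple)
    (hdim : 0 < A.dim) {Q : ℤ[X]} (hQ : A.IsFrobCharpoly Q) (hdvd : m ∣ Q) : Q = m ^ e := by
  obtain ⟨he, A', hA', hP'⟩ := h
  have hmdeg : 0 < m.natDegree := hm.natDegree_pos.2 hirr.ne_one
  have hdim' : 0 < A'.dim := hP'.dim_pos (by rw [hm.natDegree_pow]; exact Nat.mul_pos he hmdeg)
  obtain ⟨α, hα, hα'⟩ := exists_mem_roots_and_mem_roots_pow_of_dvd hm hmdeg hQ.monic hdvd he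
  exact hT A A' hA hA' hdim hdim' Q (m ^ e) hQ hP' ⟨α, hα, hα'⟩

omit [Finite K] in
/-- Roots of a divisor of a monic `h` are roots of `h`. [folklore] -/
theorem frobRoots_subset_of_dvd {m h : ℤ[X]} (hh : h.Monic) (hdvd : m ∣ h) :
    ∀ α ∈ frobRoots m, α ∈ frobRoots h := by
  intro α hα
  exact Multiset.mem_of_le
    (Polynomial.roots.le_of_dvd (hh.map _).ne_zero (Polynomial.map_dvd _ hdvd)) hα

/-- **RH ⟹ a period family.**  If `h` is monic and RH-true then (Honda–Tate) every monic irreducible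
factor of `h` has a Honda–Tate period; choose one for each. [PROVED from `hondaTateExistence`] -/
theorem exists_periodFamily_of_rh (hHT : AbelianVariety.hondaTateExistence K) {h : ℤ[X]} (hh : h.Monic)
    (hRH : ∀ α ∈ frobRoots h, ‖α‖ = Real.sqrt (Nat.card K)) :
    ∃ e : ℤ[X] → ℕ, ∀ m : ℤ[X], m.Monic → Irreducible m → m ∣ h → IsHTPeriod K m (e m) := by
  classical
  have H : ∀ m : ℤ[X], m.Monic ∧ Irreducible m ∧ m ∣ h → ∃ e : ℕ, IsHTPeriod K m e :=
    fun m hq => exists_isHTPeriod_of_rh hHT hq.1 hq.2.1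
      (fun α hα => hRH α (frobRoots_subset_of_dvd hh hq.2.2 α hα))
  refine ⟨fun m => if hq : m.Monic ∧ Irreducible m ∧ m ∣ h then Classical.choose (H m hq) else 0, ?_⟩
  intro m hm hirr hdvd
  have hq : m.Monic ∧ Irreducible m ∧ m ∣ h := ⟨hm, hirr, hdvd⟩
  simp only [hq, and_self, dif_pos]
  exact Classical.choose_spec (H m hq)

/-- Conversely a period family for the factors of a monic `h` of positive degree makes `h` RH-true
(Weil): every complex root of `h` is a root of a monic irreducible factor. [PROVED from
`weilRiemannHypothesis`] -/
theorem rh_of_periodFamily (hW : ∀ A : AbelianVariety K, A.weilRiemannHypothesis) {h : ℤ[X]}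
    (hh : h.Monic) {e : ℤ[X] → ℕ}
    (he : ∀ m : ℤ[X], m.Monic → Irreducible m → m ∣ h → IsHTPeriod K m (e m)) :
    ∀ α ∈ frobRoots h, ‖α‖ = Real.sqrt (Nat.card K) := by
  revert he
  refine monic_peel_induction (Pr := fun h => (∀ m : ℤ[X], m.Monic → Irreducible m → m ∣ h →
      IsHTPeriod K m (e m)) → ∀ α ∈ frobRoots h, ‖α‖ = Real.sqrt (Nat.card K)) ?_ ?_ h hh
  · intro _ α hα
    simp [frobRoots] at hα
  · intro m k g hm hirr hk hg _ ih he α hα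
    have hne : ((m ^ k * g).map (Int.castRingHom ℂ)) ≠ 0 := (((hm.pow k).mul hg).map _).ne_zero
    unfold frobRoots at hα
    rw [Polynomial.map_mul, Polynomial.map_pow] at hα hne
    rw [Polynomial.roots_mul hne, Multiset.mem_add, Polynomial.roots_pow, Multiset.mem_nsmul] at hα
    rcases hα with ⟨-, hαm⟩ | hαg
    · exact (he m hm hirr (dvd_mul_of_dvd_left (dvd_pow_self m hk.ne') g)).rh hW α hαm
    · exact ih (fun m' hm' hirr' hd => he m' hm' hirr' (hd.trans (dvd_mul_left g _))) α hαg

/-- **Existence of an admissible exponent from a period family** (no named fact): some `E ≥ 1` is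
divisible by every period `e_m`, `m` a monic irreducible factor of `h`. [PROVED] -/
theorem exists_pos_forall_period_dvd {h : ℤ[X]} (hh : h.Monic) {e : ℤ[X] → ℕ}
    (he : ∀ m : ℤ[X], m.Monic → Irreducible m → m ∣ h → IsHTPeriod K m (e m)) :
    ∃ E : ℕ, 0 < E ∧ ∀ m : ℤ[X], m.Monic → Irreducible m → m ∣ h → e m ∣ E := by
  revert he
  refine monic_peel_induction (Pr := fun h =>
      (∀ m : ℤ[X], m.Monic → Irreducible m → m ∣ h → IsHTPeriod K m (e m)) →
      ∃ E : ℕ, 0 < E ∧ ∀ m : ℤ[X], m.Monic → Irreducible m → m ∣ h → e m ∣ E) ?_ ?_ h hh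
  · intro _
    exact ⟨1, Nat.one_pos, fun m _ hirr hd => absurd (isUnit_of_dvd_one hd) hirr.not_isUnit⟩
  · intro m k g hm hirr hk hg _ ih he
    obtain ⟨E', hE', hdvd'⟩ := ih (fun m' hm' hirr' hd => he m' hm' hirr' (hd.trans (dvd_mul_left g _)))
    have hem0 : 0 < e m := (he m hm hirr (dvd_mul_of_dvd_left (dvd_pow_self m hk.ne') g)).1
    refine ⟨e m * E', Nat.mul_pos hem0 hE', fun m' hm' hirr' hd => ?_⟩
    rcases eq_or_dvd_of_dvd_pow_mul hm hirr hm' hirr' hd with rfl | hdg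
    · exact dvd_mul_right _ _
    · exact (hdvd' m' hm' hirr' hdg).trans (dvd_mul_left _ _)

/-- **RH ⟺ existence of a period family** (Honda–Tate for ⇒, Weil for ⇐). [PROVED from `hW`, `hHT`] -/
theorem rh_iff_exists_periodFamily (hW : ∀ A : AbelianVariety K, A.weilRiemannHypothesis)
    (hHT : AbelianVariety.hondaTateExistence K) {h : ℤ[X]} (hh : h.Monic) :
    (∀ α ∈ frobRoots h, ‖α‖ = Real.sqrt (Nat.card K)) ↔
      ∃ e : ℤ[X] → ℕ, ∀ m : ℤ[X], m.Monic → Irreducible m → m ∣ h → IsHTPeriod K m (e m) :=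
  ⟨exists_periodFamily_of_rh hHT hh, fun ⟨_, he⟩ => rh_of_periodFamily hW hh he⟩

end Summit.RiemannHypothesis.RiemannHypothesis.Theorems.MotivicDoor.FunctionField
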